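import Summits.CriticalPhenomena.SAWScalingLimit.Theorems.SAWLoopFugacityFlowSimpleSubseqLimitsStubPassage
import Summits.CriticalPhenomena.SAWScalingLimit.Theorems.SAWLoopFugacityFlowSimpleSubseqLimitsLineGlue
import HarnessLib

/-!
# Limit passage for shadow events — stub `stub_shadowPassage` of the line `marked-point-revisit`
(reshape v2; crux `SAWLoopFugacityFlow.SimpleSubseqLimits`, stmt-CriticalPhenomena-4982; registered
skeleton `Summits/CriticalPhenomena/SAWScalingLimit/Cruxes/SimpleSubseqLimits/Lines/marked_point_revisit.lean`)

The soft step of the reshaped line: from the ONE lattice input `ShadowDecayAt D a b` (small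
probability, eventually as the mesh `δ → 0⁺`, of the OPEN thickened event `nearShadowEvent η ρ ε` of
the curve class of the walk) and weak convergence of the critical SAW laws along `s n → 0⁺` to the
probability measure `ν` (`Glue.IsSubseqLimit`), the limit gives mass `0` to every shadow event
`shadowEvent η ρ` (`0 < η`, `0 < ρ`).

Proof.
1. INCLUSION (`shadowEvent_subset_nearShadowEvent`): `shadowEvent η ρ ⊆ nearShadowEvent η' ρ' ε`
   for `η' < η`, `ρ' < ρ`, `0 < ε` (same witnessing times; an exact revisit is an `ε`-near one).
2. OPENNESS (`isOpen_setOf_nearShadows`): `{γ | NearShadows γ η ρ ε}` is open for the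
   reparametrisation pseudo-distance on `Curve ℂ` — all inequalities are strict; the universal
   clause ranges over the compact interval `[t, t']`, on which a uniform slack is extracted by
   `IsCompact.induction_on` (locally one past time `v` serves a whole neighbourhood, with a margin);
   a nearby curve has a uniformly close reparametrisation (`Curve.exists_dist_reparam_lt`) and the
   order isomorphism transports the witnessing times (same device as the landed
   `Passage.isOpen_setOf_nearRevisit`).
3. IMAGE FORM: `nearShadowEvent = CurveClass.mk '' {NearShadows}` and, open sets of curves being
   saturated (`Passage.mk_mem_image_mk_iff`), the lattice event `{γ | γ.curve ∈ nearShadowEvent …}`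
   is the polyline event `{γ | NearShadows (latticeCurve γ) …}`.
4. PORTMANTEAU (`Passage.measure_image_mk_le_limsup_law`):
   `ν (nearShadowEvent …) ≤ limsup_{δ → 0⁺} P_δ {NearShadows (latticeCurve ·) …}`.
5. DECAY: `ShadowDecayAt` bounds the right side by `ENNReal.ofReal θ` eventually, hence its
   `limsup`; so `ν (shadowEvent η ρ) ≤ ENNReal.ofReal θ` for every `θ > 0`, i.e. `= 0`.

The predicates below are VERBATIM copies of the shared vocabulary of the line (the registered
skeleton), kept in the sub-namespace `…MarkedPointRevisit.ShadowPassage` so that they can never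
collide with the skeleton's or the sibling stub files' copies; they agree with those by `Iff.rfl` /
`rfl`.  `IsSubseqLimit` is the landed `Glue.IsSubseqLimit`.
-/

noncomputable section

open MeasureTheory Filter Topology Set Metric Function
open Literature.Probability.RandomPlanarGeometry Literature.Probability.LatticeModels
open scoped ENNReal NNReal BoundedContinuousFunction unitInterval

namespace Summit.CriticalPhenomena.SAWScalingLimit.Theorems.SimpleSubseqLimits.MarkedPointRevisit.ShadowPassage

open Summit.CriticalPhenomena.SAWScalingLimit.Theorems.SimpleSubseqLimits.MarkedPointRevisit.Glue
  (IsSubseqLimit)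
open Summit.CriticalPhenomena.SAWScalingLimit.Theorems.SimpleSubseqLimits.MarkedPointRevisit.Passage
  (latticeCurve mk_mem_image_mk_iff measure_image_mk_le_limsup_law)

/-! ### Vocabulary (verbatim copies) -/

/-- `γ` **`(η, ρ)`-shadows its own past**: after some time `s₀` it travels through a stretch
`[t, t']` of displacement `≥ η` every point of which was already visited before `s₀` at a point at
distance `≥ ρ` from `γ s₀` ("travelling along the own past outside the `ρ`-ball at the tip").
[folklore] -/
def Shadows (γ : Curve ℂ) (η ρ : ℝ) : Prop :=
  ∃ s₀ t t' : I, s₀ ≤ t ∧ t ≤ t' ∧ η ≤ dist (γ t) (γ t') ∧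
    ∀ u : I, t ≤ u → u ≤ t' → γ u ∈ γ '' {v : I | v ≤ s₀ ∧ ρ ≤ dist (γ v) (γ s₀)}

/-- The event "some representative `(η, ρ)`-shadows its own past" on curve classes. [folklore] -/
def shadowEvent (η ρ : ℝ) : Set (CurveClass ℂ) :=
  {c | ∃ γ : Curve ℂ, CurveClass.mk γ = c ∧ Shadows γ η ρ}

/-- Lattice-visible **`ε`-near shadowing**: after `s₀`, a stretch of displacement `> η` stays
within (open) distance `ε` of past points at distance `> ρ` from `γ s₀` (strict inequalities: an
OPEN event). [folklore] -/
def NearShadows (γ : Curve ℂ) (η ρ ε : ℝ) : Prop :=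
  ∃ s₀ t t' : I, s₀ ≤ t ∧ t ≤ t' ∧ η < dist (γ t) (γ t') ∧
    ∀ u : I, t ≤ u → u ≤ t' → ∃ v : I, v ≤ s₀ ∧ ρ < dist (γ v) (γ s₀) ∧ dist (γ u) (γ v) < ε

/-- The event "some representative `ε`-nearly `(η, ρ)`-shadows its own past". [folklore] -/
def nearShadowEvent (η ρ ε : ℝ) : Set (CurveClass ℂ) :=
  {c | ∃ γ : Curve ℂ, CurveClass.mk γ = c ∧ NearShadows γ η ρ ε}

/-- **Discrete shadow decay at `(D; a_δ, b_δ)`** (the line's ONE lattice input, sibling line's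
`ShadowDecayAt` verbatim): for all thresholds `η, ρ` and every target `θ` there is a width `ε > 0`
(depending on `D`: a domain with an `η`-long corridor of width `< ε` forces near-shadowing, so NO
domain-uniform version is true) such that for all small meshes the critical SAW `ε`-nearly shadows an
`η`-stretch of its `ρ`-far past with probability `≤ θ`.  An unconditional probability of an OPEN event
of the curve class of the walk; an `x_c`-statement (false for `x > x_c`); implied by the summit
conjecture and necessary given `EventualTight`. [folklore] -/
def ShadowDecayAt (D : DobrushinDomain) (a b : ℝ → Site 2) : Prop :=
  ∀ η ρ θ : ℝ, 0 < η → 0 < ρ → 0 < θ → ∃ ε : ℝ, 0 < ε ∧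
    ∀ᶠ δ in 𝓝[>] (0 : ℝ),
      SAW.law D.carrier δ (a δ) (b δ) {γ | γ.curve ∈ nearShadowEvent η ρ ε} ≤ ENNReal.ofReal θ

/-! ### Step 1: exact shadowing is near shadowing for all smaller thresholds -/

/-- An exact `(η, ρ)`-shadowing is an `ε`-near `(η', ρ')`-shadowing for all `η' < η`, `ρ' < ρ`,
`ε > 0` (same witnessing times; the past point hit exactly is at distance `0 < ε`). [folklore] -/
theorem nearShadows_of_shadows {γ : Curve ℂ} {η ρ η' ρ' ε : ℝ} (hη : η' < η) (hρ : ρ' < ρ)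
    (hε : 0 < ε) (h : Shadows γ η ρ) : NearShadows γ η' ρ' ε := by
  obtain ⟨s₀, t, t', hst, htt, hd, H⟩ := h
  refine ⟨s₀, t, t', hst, htt, hη.trans_le hd, fun u hu hu' => ?_⟩
  obtain ⟨v, ⟨hv, hρv⟩, huv⟩ := H u hu hu'
  refine ⟨v, hv, hρ.trans_le hρv, ?_⟩
  rw [← huv, dist_self]
  exact hε

/-- `shadowEvent η ρ ⊆ nearShadowEvent η' ρ' ε` for `η' < η`, `ρ' < ρ`, `ε > 0`. [folklore] -/
theorem shadowEvent_subset_nearShadowEvent {η ρ η' ρ' ε : ℝ} (hη : η' < η) (hρ : ρ' < ρ)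
    (hε : 0 < ε) : shadowEvent η ρ ⊆ nearShadowEvent η' ρ' ε :=
  fun _ ⟨γ, hγ, h⟩ => ⟨γ, hγ, nearShadows_of_shadows hη hρ hε h⟩

/-! ### Step 2: the thickened configuration is open -/

/-- **Uniform slack** for the universal clause of `NearShadows` on a compact set of times: if every
`u ∈ K` has a past time `v ≤ s₀` with `ρ < dist (γ v) (γ s₀)` and `dist (γ u) (γ v) < ε`, then
there is ONE margin `sl > 0` serving all `u ∈ K` (locally the same `v` serves a neighbourhood of `u`
by continuity of `γ`; `IsCompact.induction_on`). [folklore] -/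
theorem exists_uniform_slack (γ : Curve ℂ) {K : Set I} (hK : IsCompact K) (s₀ : I) {ρ ε : ℝ}
    (H : ∀ u ∈ K, ∃ v : I, v ≤ s₀ ∧ ρ < dist (γ v) (γ s₀) ∧ dist (γ u) (γ v) < ε) :
    ∃ sl : ℝ, 0 < sl ∧ ∀ u ∈ K, ∃ v : I, v ≤ s₀ ∧
      ρ + sl < dist (γ v) (γ s₀) ∧ dist (γ u) (γ v) + sl < ε := by
  refine hK.induction_on (p := fun A => ∃ sl : ℝ, 0 < sl ∧ ∀ u ∈ A, ∃ v : I, v ≤ s₀ ∧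
      ρ + sl < dist (γ v) (γ s₀) ∧ dist (γ u) (γ v) + sl < ε) ?_ ?_ ?_ ?_
  · exact ⟨1, one_pos, fun u hu => hu.elim⟩
  · rintro A B hAB ⟨sl, hsl, h⟩
    exact ⟨sl, hsl, fun u hu => h u (hAB hu)⟩
  · rintro A B ⟨sl₁, hsl₁, h₁⟩ ⟨sl₂, hsl₂, h₂⟩
    refine ⟨min sl₁ sl₂, lt_min hsl₁ hsl₂, ?_⟩
    rintro u (hu | hu)
    · obtain ⟨v, hv, hv₁, hv₂⟩ := h₁ u hu
      exact ⟨v, hv, by linarith [min_le_left sl₁ sl₂], by linarith [min_le_left sl₁ sl₂]⟩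
    · obtain ⟨v, hv, hv₁, hv₂⟩ := h₂ u hu
      exact ⟨v, hv, by linarith [min_le_right sl₁ sl₂], by linarith [min_le_right sl₁ sl₂]⟩
  · intro x hx
    obtain ⟨v, hv, h₁, h₂⟩ := H x hx
    have hc : Continuous fun w : I => dist (γ w) (γ v) := γ.continuous.dist continuous_const
    refine ⟨{w : I | dist (γ w) (γ v) < dist (γ x) (γ v) + (ε - dist (γ x) (γ v)) / 2},
      mem_nhdsWithin_of_mem_nhds ((isOpen_lt hc continuous_const).mem_nhds ?_), ?_⟩
    · show dist (γ x) (γ v) < dist (γ x) (γ v) + (ε - dist (γ x) (γ v)) / 2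
      linarith
    · refine ⟨min (dist (γ v) (γ s₀) - ρ) (ε - dist (γ x) (γ v)) / 2,
        half_pos (lt_min (sub_pos.2 h₁) (sub_pos.2 h₂)), fun w hw => ⟨v, hv, ?_, ?_⟩⟩
      · linarith [min_le_left (dist (γ v) (γ s₀) - ρ) (ε - dist (γ x) (γ v))]
      · have hw' : dist (γ w) (γ v) < dist (γ x) (γ v) + (ε - dist (γ x) (γ v)) / 2 := hw
        linarith [min_le_right (dist (γ v) (γ s₀) - ρ) (ε - dist (γ x) (γ v))]

/-- **Openness of the thickened shadowing configuration** for the reparametrisation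
pseudo-distance on `Curve ℂ`: fix witnessing times `s₀ ≤ t ≤ t'` for `γ`; the displacement clause
has a positive slack and the universal clause a uniform one on the compact interval `[t, t']`
(`exists_uniform_slack`); a curve `γ'` at distance `< slack / 2` has a reparametrisation `φ` with
`γ' ∘ φ` uniformly close to `γ` (`Curve.exists_dist_reparam_lt`), and `(φ s₀, φ t, φ t')` (with the
past times `φ v`) witnesses the configuration for `γ'`. [folklore] -/
theorem isOpen_setOf_nearShadows (η ρ ε : ℝ) :
    IsOpen {γ : Curve ℂ | NearShadows γ η ρ ε} := by
  rw [Metric.isOpen_iff]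
  rintro γ ⟨s₀, t, t', hst, htt, hη, H⟩
  obtain ⟨sl, hsl, hK⟩ := exists_uniform_slack γ (isClosed_Icc (a := t) (b := t')).isCompact s₀
    (ρ := ρ) (ε := ε) fun u hu => H u hu.1 hu.2
  obtain ⟨d, hd0, hd1, hd2⟩ : ∃ d : ℝ, 0 < d ∧ 2 * d ≤ sl ∧ 2 * d ≤ dist (γ t) (γ t') - η :=
    ⟨min sl (dist (γ t) (γ t') - η) / 2, half_pos (lt_min hsl (sub_pos.2 hη)),
      by linarith [min_le_left sl (dist (γ t) (γ t') - η)],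
      by linarith [min_le_right sl (dist (γ t) (γ t') - η)]⟩
  refine ⟨d, hd0, fun γ' hγ' => ?_⟩
  rw [Metric.mem_ball, dist_comm] at hγ'
  obtain ⟨φ, hφ⟩ := Curve.exists_dist_reparam_lt hγ'
  have hcl : ∀ u, dist (γ u) (γ' (φ u)) < d := fun u => by
    have h := ContinuousMap.dist_apply_le_dist (f := γ.toContinuousMap)
      (g := (γ'.reparam φ).toContinuousMap) (x := u)
    simp only [Curve.coe_toContinuousMap, Curve.reparam_apply] at h
    exact h.trans_lt hφ
  have hcl' : ∀ u', dist (γ (φ.symm u')) (γ' u') < d := fun u' => by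
    simpa only [OrderIso.apply_symm_apply] using hcl (φ.symm u')
  refine ⟨φ s₀, φ t, φ t', φ.le_iff_le.2 hst, φ.le_iff_le.2 htt, ?_, ?_⟩
  · have h₁ := dist_triangle (γ t) (γ' (φ t)) (γ t')
    have h₂ := dist_triangle (γ' (φ t)) (γ' (φ t')) (γ t')
    have h₃ := hcl t
    have h₄ := hcl t'
    rw [dist_comm] at h₄
    linarith
  · intro u' hl hT
    obtain ⟨v, hv, hv₁, hv₂⟩ := hK (φ.symm u') ⟨φ.le_symm_apply.2 hl, φ.symm_apply_le.2 hT⟩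
    refine ⟨φ v, φ.le_iff_le.2 hv, ?_, ?_⟩
    · have h₁ := dist_triangle (γ v) (γ' (φ v)) (γ s₀)
      have h₂ := dist_triangle (γ' (φ v)) (γ' (φ s₀)) (γ s₀)
      have h₃ := hcl v
      have h₄ := hcl s₀
      rw [dist_comm] at h₄
      linarith
    · have h₁ := dist_triangle_left (γ' u') (γ' (φ v)) (γ (φ.symm u'))
      have h₂ := dist_triangle (γ (φ.symm u')) (γ v) (γ' (φ v))
      have h₃ := hcl' u'
      have h₄ := hcl v
      linarith

/-- The thickened event is the image of the open configuration set under the quotient map.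
[folklore] -/
theorem nearShadowEvent_eq_image (η ρ ε : ℝ) :
    nearShadowEvent η ρ ε = CurveClass.mk '' {γ | NearShadows γ η ρ ε} :=
  Set.ext fun _ => exists_congr fun _ => and_comm

/-- **The thickened shadowing event is open** in `CurveClass ℂ` (`SeparationQuotient.mk` is an
open map). [folklore] -/
theorem isOpen_nearShadowEvent (η ρ ε : ℝ) : IsOpen (nearShadowEvent η ρ ε) := by
  rw [nearShadowEvent_eq_image]
  exact SeparationQuotient.isOpenMap_mk _ (isOpen_setOf_nearShadows η ρ ε)

/-! ### Step 3: the lattice event is the polyline event -/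

/-- The lattice event `{γ | γ.curve ∈ nearShadowEvent η ρ ε}` is the polyline event
`{γ | NearShadows (latticeCurve γ) η ρ ε}` (open sets of curves are saturated for distance zero,
`Passage.mk_mem_image_mk_iff`, and `γ.curve = CurveClass.mk (latticeCurve γ)`). [folklore] -/
theorem setOf_nearShadows_latticeCurve {Ω : Set ℂ} {δ : ℝ} {u v : Site 2} (η ρ ε : ℝ) :
    {γ : SAW.DomainSAW Ω δ u v | NearShadows (latticeCurve γ) η ρ ε} =
      {γ | γ.curve ∈ nearShadowEvent η ρ ε} := by
  ext γ
  simp only [mem_setOf_eq, nearShadowEvent_eq_image]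
  exact (mk_mem_image_mk_iff (isOpen_setOf_nearShadows η ρ ε) (latticeCurve γ)).symm

/-! ### Steps 4–5: portmanteau and decay -/

/-- **Stub `stub_shadowPassage` of the line `marked-point-revisit` (v2) — LIMIT PASSAGE.** Shadow
decay at `(D; a_δ, b_δ)` + weak convergence along `s n → 0⁺` ⇒ the limit gives mass `0` to every
shadow event: `shadowEvent η ρ ⊆ nearShadowEvent (η/2) (ρ/2) ε` for every `ε > 0`;
`nearShadowEvent` is the image of an OPEN set of curves, so honesty of the laws along `s n` and
the open-set portmanteau give `ν(G) ≤ limsup_{δ→0⁺} P_δ(G)` (`Passage.measure_image_mk_le_limsup_law`),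
and `ShadowDecayAt` makes the right side `≤ ENNReal.ofReal θ` for every `θ > 0`. [folklore] -/
theorem stub_shadowPassage :
    ∀ (D : DobrushinDomain) (a b : ℝ → Site 2) (s : ℕ → ℝ) (ν : Measure (CurveClass ℂ)),
      ShadowDecayAt D a b → IsSubseqLimit D a b s ν →
        ∀ η ρ : ℝ, 0 < η → 0 < ρ → ν (shadowEvent η ρ) = 0 := by
  intro D a b s ν hSD hL η ρ hη hρ
  obtain ⟨hs, hν, hw⟩ := hL
  haveI := hν
  have hθ : ∀ θ : ℝ, 0 < θ → ν (shadowEvent η ρ) ≤ ENNReal.ofReal θ := by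
    intro θ hθ
    obtain ⟨ε, hε, hev⟩ := hSD (η / 2) (ρ / 2) θ (half_pos hη) (half_pos hρ) hθ
    calc ν (shadowEvent η ρ)
        ≤ ν (nearShadowEvent (η / 2) (ρ / 2) ε) :=
          measure_mono
            (shadowEvent_subset_nearShadowEvent (half_lt_self hη) (half_lt_self hρ) hε)
      _ = ν (CurveClass.mk '' {γ | NearShadows γ (η / 2) (ρ / 2) ε}) := by
          rw [nearShadowEvent_eq_image]
      _ ≤ limsup (fun δ : ℝ => SAW.law D.carrier δ (a δ) (b δ)
            {γ | NearShadows (latticeCurve γ) (η / 2) (ρ / 2) ε}) (𝓝[>] (0 : ℝ)) :=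
          measure_image_mk_le_limsup_law hs hw (isOpen_setOf_nearShadows _ _ _)
      _ ≤ ENNReal.ofReal θ := by
          refine limsup_le_of_le (by isBoundedDefault) (hev.mono fun δ hδ => ?_)
          rwa [setOf_nearShadows_latticeCurve]
  refine le_antisymm (ENNReal.le_of_forall_pos_le_add fun θ hθ' _ => ?_) zero_le
  rw [zero_add, ← ENNReal.ofReal_coe_nnreal]
  exact hθ θ (NNReal.coe_pos.2 hθ')

end Summit.CriticalPhenomena.SAWScalingLimit.Theorems.SimpleSubseqLimits.MarkedPointRevisit.ShadowPassage

end
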